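import Summits.QuantumFields.QCD.Theorems.SpectralDefectExtinctionTipNoBindingFreeSymbol

/-!
# Stub `stub_noLeak` of line `positivity-no-leak-spread`
(crux `Summit.QuantumFields.QCD.Theses.SpectralDefectExtinction.TipNoBinding`, item stmt-QuantumFields-8965)

**NO-LEAK**: the free massless `r = 1` Wilson–Dirac resolvent off the zero mode is bounded
`ℓ²(support S) → ℓ²` on the four-torus.  If `φ = D_W(1,0,1)ψ − tψ` vanishes outside the site set `S`
and `1/√L ≤ t ≤ 1/4`, then

  `‖ψ‖² ≤ (1/L³ + 4 K_L) · |S| · ‖φ‖²`,  `K_L = L⁻⁴ Σ_{k≠0} 1/ε_L(k)`, `ε_L(k) = Σ_μ 4 sin²(π k_μ / L)`.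

Proof (all ingredients in `…TipNoBindingFreeSymbol` and the torus Fourier toolkit of
`…TipNoBindingStubSobolevSup`): per colour `a` and momentum `k`, `q(k) Σ_α |ψ̂(k,a,α)|² = Σ_α |φ̂(k,a,α)|²`
with `q(k) = (W − t)² + Σ_μ sin² θ_μ ≥ (3/4) ε_L(k)` for `k ≠ 0` and `q(0) = t² ≥ 1/L` (this is where
the floor `t ≥ 1/√L` of the crux is spent); `|φ̂(k,a,α)|² ≤ |S| Σ_{x∈S} |φ(x,a,α)|²` (Cauchy–Schwarz on
the support); Parseval: `‖ψ‖² = L⁻⁴ Σ_k Σ_{a,α} |ψ̂|² ≤ L⁻⁴ (L + (4/3) Σ_{k≠0} 1/ε_L(k)) |S| ‖φ‖²`.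
Pure theorem file; the statement is the registered stub signature, literally.
-/

namespace Summit.QuantumFields.QCD.Cruxes.TipNoBinding.PositivityNoLeakSpread

open Literature.MathematicalPhysics Literature.MathematicalPhysics.QuantumLattice
  Literature.MathematicalPhysics.QuantumFieldTheory Literature.Probability.LatticeModels
open Matrix Complex Finset
open scoped ComplexConjugate Real

section NoLeak

/-- **NO-LEAK** (registered stub `stub_noLeak` of line `positivity-no-leak-spread`; the free resolvent
off the zero mode is bounded `ℓ²(support S) → ℓ²`): if `φ = D_W(1,0,1)ψ − tψ` vanishes outside the
site set `S` and `1/√L ≤ t ≤ 1/4`, then `‖ψ‖² ≤ (1/L³ + 4 K_L) · |S| · ‖φ‖²`, `K_L = L⁻⁴ Σ_{k≠0} 1/ε_L(k)`.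
Proof: per colour `a` and momentum `k` the free operator acts by the normal symbol `(W − t) + iγ·s`, so
`q(k) Σ_α |ψ̂(k,a,α)|² = Σ_α |φ̂(k,a,α)|²` with `q(k) = (W − t)² + Σ sin² θ_μ`
(`sum_norm_sq_torusFourier_free_sub`); `q(k) ≥ (3/4) ε_L(k)` for `k ≠ 0` (`symbol_sq_lower_bound`) and
`q(0) = t² ≥ 1/L` (the floor); `|φ̂(k,a,α)|² ≤ |S| Σ_{x∈S} |φ(x,a,α)|²` (Cauchy–Schwarz on the support);
and Parseval: `‖ψ‖² = L⁻⁴ Σ_k Σ_{a,α} |ψ̂|² ≤ L⁻⁴ (L + (4/3) Σ_{k≠0} 1/ε_L(k)) |S| ‖φ‖²`. -/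
theorem stub_noLeak :
    ∀ (L : ℕ) [NeZero L] (t : ℝ), 1 / Real.sqrt (L : ℝ) ≤ t → t ≤ 1 / 4 →
      ∀ (S : Finset (TorusSite 4 L)) (ψ : TorusSite 4 L × Fin 3 × Fin 4 → ℂ),
        (∀ i : TorusSite 4 L × Fin 3 × Fin 4, i.1 ∉ S →
          (wilsonDirac (fundamentalRep (Fin 3))
              (1 : GaugeConfig 4 L ↥(Matrix.specialUnitaryGroup (Fin 3) ℂ)) 0 1 *ᵥ ψ -
            (t : ℂ) • ψ) i = 0) →
        ∑ i, ‖ψ i‖ ^ 2 ≤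
          (1 / (L : ℝ) ^ 3 + 4 * ((1 / (L : ℝ) ^ 4) *
              ∑ k ∈ (Finset.univ : Finset (TorusSite 4 L)).filter (· ≠ 0),
                1 / (∑ μ, 4 * Real.sin (Real.pi * ((k μ).val : ℝ) / L) ^ 2))) * S.card *
            ∑ i, ‖(wilsonDirac (fundamentalRep (Fin 3))
                (1 : GaugeConfig 4 L ↥(Matrix.specialUnitaryGroup (Fin 3) ℂ)) 0 1 *ᵥ ψ -
              (t : ℂ) • ψ) i‖ ^ 2 := by
  intro L _ t ht1 ht4 S ψ hsupp
  -- the source `φ = (D₀ − t)ψ`, the symbol `q`, the Laplacian symbol `ε`, and the constants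
  set φ : TorusSite 4 L × Fin 3 × Fin 4 → ℂ := wilsonDirac (fundamentalRep (Fin 3))
      (1 : GaugeConfig 4 L ↥(Matrix.specialUnitaryGroup (Fin 3) ℂ)) 0 1 *ᵥ ψ - (t : ℂ) • ψ with hφdef
  set ε : TorusSite 4 L → ℝ := fun k => ∑ μ, 4 * Real.sin (π * ((k μ).val : ℝ) / L) ^ 2 with hεdef
  set q : TorusSite 4 L → ℝ := fun k =>
    ((∑ μ, (1 - Real.cos (2 * π * ((k μ).val : ℝ) / L))) - t) ^ 2 +
      ∑ μ, Real.sin (2 * π * ((k μ).val : ℝ) / L) ^ 2 with hqdef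
  set N : ℝ := ∑ i, ‖φ i‖ ^ 2 with hNdef
  set B : ℝ := ∑ k ∈ (Finset.univ : Finset (TorusSite 4 L)).filter (· ≠ 0), 1 / ε k with hBdef
  -- basic facts
  have hL : (0 : ℝ) < L := Nat.cast_pos.mpr (Nat.pos_of_ne_zero (NeZero.ne L))
  have ht0 : 0 < t := lt_of_lt_of_le (by positivity) ht1
  have htL : 1 / t ^ 2 ≤ (L : ℝ) := by
    have h1 : 1 / t ≤ Real.sqrt L := by
      rw [div_le_iff₀ ht0]
      have h := (div_le_iff₀ (Real.sqrt_pos.mpr hL)).mp ht1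
      linarith [mul_comm t (Real.sqrt L)]
    calc 1 / t ^ 2 = (1 / t) ^ 2 := by ring
      _ ≤ Real.sqrt L ^ 2 := pow_le_pow_left₀ (by positivity) h1 2
      _ = L := Real.sq_sqrt hL.le
  have hN0 : 0 ≤ N := Finset.sum_nonneg fun _ _ => by positivity
  have hS0 : (0 : ℝ) ≤ S.card := Nat.cast_nonneg _
  have hB0 : 0 ≤ B := Finset.sum_nonneg fun k _ => div_nonneg zero_le_one (symbol_nonneg k)
  -- the symbol: value at the zero mode, lower bound and positivity, `1/q ≤ (4/3)/ε` off zero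
  have hq0 : q 0 = t ^ 2 := symbol_sq_zero t
  have hqε : ∀ k, (3 / 4) * ε k ≤ q k := fun k => symbol_sq_lower_bound t ht4 k
  have hqpos : ∀ k, 0 < q k := by
    intro k
    by_cases hk : k = 0
    · rw [hk, hq0]
      positivity
    · have hεk : 0 < ε k := symbol_pos_of_ne_zero hk
      exact lt_of_lt_of_le (by positivity) (hqε k)
  have hinvq : ∀ k, k ≠ 0 → 1 / q k ≤ (4 / 3) * (1 / ε k) := by
    intro k hk
    have hεk : 0 < ε k := symbol_pos_of_ne_zero hk
    calc 1 / q k ≤ 1 / ((3 / 4) * ε k) := one_div_le_one_div_of_le (by positivity) (hqε k)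
      _ = (4 / 3) * (1 / ε k) := by
          field_simp
  -- the source vanishes off `S`, componentwise
  have hsuppφ : ∀ (a : Fin 3) (α : Fin 4) (x : TorusSite 4 L), x ∉ S → φ (x, a, α) = 0 :=
    fun a α x hx => hsupp (x, a, α) hx
  -- `Σ_{a,α} Σ_{x∈S} |φ(x,a,α)|² ≤ ‖φ‖²`
  have h3 : ∑ a : Fin 3, ∑ α : Fin 4, ∑ x ∈ S, ‖φ (x, a, α)‖ ^ 2 ≤ N := by
    calc ∑ a : Fin 3, ∑ α : Fin 4, ∑ x ∈ S, ‖φ (x, a, α)‖ ^ 2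
        ≤ ∑ a : Fin 3, ∑ α : Fin 4, ∑ x, ‖φ (x, a, α)‖ ^ 2 :=
          Finset.sum_le_sum fun a _ => Finset.sum_le_sum fun α _ =>
            Finset.sum_le_sum_of_subset_of_nonneg (Finset.subset_univ S) fun _ _ _ => by positivity
      _ = N := by
          symm
          calc N = ∑ x, ∑ p : Fin 3 × Fin 4, ‖φ (x, p)‖ ^ 2 := by rw [hNdef, Fintype.sum_prod_type]
            _ = ∑ p : Fin 3 × Fin 4, ∑ x, ‖φ (x, p)‖ ^ 2 := Finset.sum_comm
            _ = ∑ a : Fin 3, ∑ α : Fin 4, ∑ x, ‖φ (x, a, α)‖ ^ 2 := by rw [Fintype.sum_prod_type]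
  -- per momentum: `Σ_{a,α} |ψ̂(k,a,α)|² ≤ (1/q k) · |S| · ‖φ‖²`
  have hk : ∀ k, ∑ a, ∑ α, ‖torusFourier (fun x => ψ (x, a, α)) k‖ ^ 2 ≤ (1 / q k) * (S.card * N) := by
    intro k
    have h1 : ∀ a, q k * ∑ α, ‖torusFourier (fun x => ψ (x, a, α)) k‖ ^ 2 =
        ∑ α, ‖torusFourier (fun x => φ (x, a, α)) k‖ ^ 2 := fun a =>
      (sum_norm_sq_torusFourier_free_sub L ψ t k a).symm
    have h2 : ∀ a α, ‖torusFourier (fun x => φ (x, a, α)) k‖ ^ 2 ≤ S.card * ∑ x ∈ S, ‖φ (x, a, α)‖ ^ 2 :=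
      fun a α => norm_sq_torusFourier_le_card_mul _ S (hsuppφ a α) k
    have hmain : q k * ∑ a, ∑ α, ‖torusFourier (fun x => ψ (x, a, α)) k‖ ^ 2 ≤ S.card * N := by
      rw [Finset.mul_sum]
      simp_rw [h1]
      calc ∑ a, ∑ α, ‖torusFourier (fun x => φ (x, a, α)) k‖ ^ 2
          ≤ ∑ a, ∑ α, ((S.card : ℝ) * ∑ x ∈ S, ‖φ (x, a, α)‖ ^ 2) :=
            Finset.sum_le_sum fun a _ => Finset.sum_le_sum fun α _ => h2 a α
        _ = S.card * ∑ a, ∑ α, ∑ x ∈ S, ‖φ (x, a, α)‖ ^ 2 := by simp_rw [Finset.mul_sum]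
        _ ≤ S.card * N := mul_le_mul_of_nonneg_left h3 hS0
    rw [one_div, inv_mul_eq_div]
    exact (le_div_iff₀' (hqpos k)).mpr hmain
  -- Parseval, all components: `‖ψ‖² = L⁻⁴ Σ_k Σ_{a,α} |ψ̂(k,a,α)|²`
  have hP : ∑ i, ‖ψ i‖ ^ 2 =
      (1 / (L : ℝ) ^ 4) * ∑ k, ∑ a, ∑ α, ‖torusFourier (fun x => ψ (x, a, α)) k‖ ^ 2 := by
    calc ∑ i, ‖ψ i‖ ^ 2 = ∑ x, ∑ p : Fin 3 × Fin 4, ‖ψ (x, p)‖ ^ 2 := by rw [Fintype.sum_prod_type]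
      _ = ∑ p : Fin 3 × Fin 4, ∑ x, ‖ψ (x, p)‖ ^ 2 := Finset.sum_comm
      _ = ∑ a : Fin 3, ∑ α : Fin 4, ∑ x, ‖ψ (x, a, α)‖ ^ 2 := by rw [Fintype.sum_prod_type]
      _ = ∑ a : Fin 3, ∑ α : Fin 4,
            (1 / (L : ℝ) ^ 4) * ∑ k, ‖torusFourier (fun x => ψ (x, a, α)) k‖ ^ 2 :=
          Finset.sum_congr rfl fun a _ => Finset.sum_congr rfl fun α _ =>
            sum_norm_sq_eq_fourier (fun x => ψ (x, a, α))
      _ = (1 / (L : ℝ) ^ 4) *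
            ∑ a : Fin 3, ∑ α : Fin 4, ∑ k, ‖torusFourier (fun x => ψ (x, a, α)) k‖ ^ 2 := by
          simp only [← Finset.mul_sum]
      _ = (1 / (L : ℝ) ^ 4) *
            ∑ a : Fin 3, ∑ k, ∑ α : Fin 4, ‖torusFourier (fun x => ψ (x, a, α)) k‖ ^ 2 := by
          congr 1
          exact Finset.sum_congr rfl fun a _ => Finset.sum_comm
      _ = (1 / (L : ℝ) ^ 4) *
            ∑ k, ∑ a : Fin 3, ∑ α : Fin 4, ‖torusFourier (fun x => ψ (x, a, α)) k‖ ^ 2 := by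
          congr 1
          exact Finset.sum_comm
  -- sum over momenta of `1/q`: zero mode `1/t² ≤ L`, the rest against `(4/3)/ε`
  have hsumq : ∑ k, 1 / q k ≤ (L : ℝ) + (4 / 3) * B := by
    rw [← Finset.add_sum_erase _ _ (Finset.mem_univ (0 : TorusSite 4 L)), ← Finset.filter_ne', hq0,
      hBdef, Finset.mul_sum]
    exact add_le_add htL (Finset.sum_le_sum fun k hk' => hinvq k (Finset.mem_filter.mp hk').2)
  -- assemble
  have hL4 : (0 : ℝ) < 1 / (L : ℝ) ^ 4 := by positivity
  calc ∑ i, ‖ψ i‖ ^ 2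
      = (1 / (L : ℝ) ^ 4) * ∑ k, ∑ a, ∑ α, ‖torusFourier (fun x => ψ (x, a, α)) k‖ ^ 2 := hP
    _ ≤ (1 / (L : ℝ) ^ 4) * ∑ k, (1 / q k) * (S.card * N) :=
        mul_le_mul_of_nonneg_left (Finset.sum_le_sum fun k _ => hk k) hL4.le
    _ = (1 / (L : ℝ) ^ 4) * (∑ k, 1 / q k) * (S.card * N) := by
        rw [← Finset.sum_mul, mul_assoc]
    _ ≤ (1 / (L : ℝ) ^ 4) * ((L : ℝ) + (4 / 3) * B) * (S.card * N) := by
        have h := mul_le_mul_of_nonneg_left hsumq hL4.le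
        exact mul_le_mul_of_nonneg_right h (by positivity)
    _ ≤ (1 / (L : ℝ) ^ 3 + 4 * ((1 / (L : ℝ) ^ 4) * B)) * S.card * N := by
        have h1 : (1 / (L : ℝ) ^ 4) * ((L : ℝ) + (4 / 3) * B) ≤
            1 / (L : ℝ) ^ 3 + 4 * ((1 / (L : ℝ) ^ 4) * B) := by
          have h2 : (1 / (L : ℝ) ^ 4) * (L : ℝ) = 1 / (L : ℝ) ^ 3 := by
            field_simp
          have h3 : (1 / (L : ℝ) ^ 4) * ((4 / 3) * B) ≤ 4 * ((1 / (L : ℝ) ^ 4) * B) := by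
            have : 0 ≤ (1 / (L : ℝ) ^ 4) * B := by positivity
            nlinarith [this]
          rw [mul_add, h2]
          linarith [h3]
        calc (1 / (L : ℝ) ^ 4) * ((L : ℝ) + (4 / 3) * B) * (S.card * N)
            = ((1 / (L : ℝ) ^ 4) * ((L : ℝ) + (4 / 3) * B)) * (S.card * N) := by ring
          _ ≤ (1 / (L : ℝ) ^ 3 + 4 * ((1 / (L : ℝ) ^ 4) * B)) * (S.card * N) :=
              mul_le_mul_of_nonneg_right h1 (by positivity)
          _ = (1 / (L : ℝ) ^ 3 + 4 * ((1 / (L : ℝ) ^ 4) * B)) * S.card * N := by ring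

end NoLeak

end Summit.QuantumFields.QCD.Cruxes.TipNoBinding.PositivityNoLeakSpread
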